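import Literature.Barriers.ValiantsHypothesis.NoncommutativeExtensions
import HarnessLib

/-!
# Hrubeš–Yehudayoff 2011, §4 "Extensions of small dimension": Lemma 4.1 (balancing) and
Theorem 4.2 (formula half), proofs

Companion to `NoncommutativeExtensions.lean` (the barrier) and
`NoncommutativeExtensionsProofs.lean` (Thm. 3.4). This file discharges the named fact
`Literature.Barriers.ValiantsHypothesis.HrubesYehudayoff2011_thm42_formulas` of
`NoncommutativeExtensions.lean` ("extensions of small dimension do not help much":
`L_R(f) ≤ L_{R'}(f)^{O(log k)}` when `dim_R(R') = k`), with the explicit constant `c = 114`, i.e.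
`L_R(f) ≤ L_{R'}(f)^(114 (⌊log₂ k⌋ + 1))`, following the printed proof
(Theory of Computing 7 (2011) 119–129, §4, checked with `lit read`):

* Lemma 4.1 ("formulas can be assumed to be balanced": `c⁻¹ D_R(f) ≤ log L_R(f) ≤ D_R(f)`), proved
  here as `NCFormula.exists_depth_le_log` (every formula of size `s` is equivalent to one of depth
  `≤ 12 ⌊log₂ s⌋ + 16`) and packaged as `log_ncFormulaSize_le_ncFormulaDepth` /
  `ncFormulaDepth_le_log_ncFormulaSize` / `ncFormulaDepth_le_mul_log_ncFormulaSize`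
  (`D ≤ 28 log₂ L`). The printed proof picks a node `u` whose subformula has
  size in `[s/3, 2s/3]` and rewrites `Φ` in terms of `Φ_u` and the formula with `u` replaced by a
  constant ("this follows by induction on the structure of `Φ`"). Over a NONcommutative coefficient
  ring the correct form of that identity is `Φ = A · Φ_u · B + C` with `A`, `B` the ordered products
  of the left/right cofactors met on the path from `u` to the root and `C` the rest
  (`NCFormula.splitAt`, `NCFormula.eval_splitAt`); each of `A, B, C` has size `≤ s - |Φ_u| + 1`
  (`NCFormula.splitAt_sizes`), so with threshold `t = ⌊s/3⌋ + 1` all four pieces have size `≤ 5s/6`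
  once `s ≥ 6`, and the depth recursion `D(s) ≤ D(5s/6) + 3` gives `D = O(log s)`
  (`NCFormula.exists_depth_le_of_size`).
* Theorem 4.2, formulas: "For formula size, we use Lemma 4.1": balance a smallest formula `Φ` for
  `f` over `R'` to depth `O(log s)`; simulate it over `R` componentwise in the basis
  `e_1 = 1, …, e_k` ("for every node `u` … `k` nodes `u_1, …, u_k` computing `ĝ_u`"; sums
  coordinatewise, products through the bilinear maps `λ_i` given by the structure constants
  `(e_i e_j)_l`, each of depth `O(log k)` — here balanced binary sums `NCFormula.finSum`), which
  multiplies depth by `O(log k)` (`NCFormula.depth_sim_le`); the output coordinate at `e_{i₀} = 1`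
  computes `f` (`coordPoly_baseChange`); finally unfold depth into size, `L < 2^(D+1)`
  (`NCFormula.size_lt_two_pow_depth`), giving `L_R(f) ≤ 2^{O(log s · log k)} = s^{O(log k)}`.

Constants are not optimised. The circuit half of Thm. 4.2 (`C_R(f) ≤ O(k³) C_{R'}(f)`) is not
treated (the tree's `NCFormula` model has formulas only).

## References

* [HrubesYehudayoff2011] P. Hrubeš, A. Yehudayoff, *Arithmetic complexity in ring extensions*,
  Theory of Computing 7 (2011) 119–129, §2 (depth, `dim_R`), Lemma 4.1, Theorem 4.2.
-/

noncomputable section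

namespace Literature.Barriers.ValiantsHypothesis

open AddMonoidAlgebra

universe u v

namespace NCFormula

/-- The four pieces of a formula split at a node `u`: `φ = a × g × b + c`, `g = φ_u`.
[cite: HrubesYehudayoff2011, Lemma 4.1 (proof: "this follows by induction on the structure of Φ")] -/
structure Pieces (A : Type u) (σ : Type v) : Type (max u v) where
  /-- the ordered product of the left cofactors on the path from `u` to the root -/
  a : NCFormula A σ
  /-- the subformula `φ_u` split off -/
  g : NCFormula A σ
  /-- the ordered product of the right cofactors on the path from `u` to the root -/
  b : NCFormula A σ
  /-- the remainder: `φ` with `φ_u` replaced by `0`, simplified -/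
  c : NCFormula A σ

variable {A : Type u} {σ : Type v}

/-! ### Depth -/

/-- The depth of a formula: the number of edges on a longest root-to-leaf path (leaves have
depth `0`). [cite: HrubesYehudayoff2011, §2 ("the depth of a circuit is the length of the longest directed path")] -/
def depth : NCFormula A σ → ℕ
  | var _ => 0
  | const _ => 0
  | add φ ψ => max φ.depth ψ.depth + 1
  | mul φ ψ => max φ.depth ψ.depth + 1

/-- Unfolding of `depth`. [folklore] -/
@[simp] theorem depth_var (i : σ) : (var i : NCFormula A σ).depth = 0 := rfl
/-- Unfolding of `depth`. [folklore] -/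
@[simp] theorem depth_const (c : A) : (const c : NCFormula A σ).depth = 0 := rfl
/-- Unfolding of `depth`. [folklore] -/
@[simp] theorem depth_add (φ ψ : NCFormula A σ) :
    (add φ ψ).depth = max φ.depth ψ.depth + 1 := rfl
/-- Unfolding of `depth`. [folklore] -/
@[simp] theorem depth_mul (φ ψ : NCFormula A σ) :
    (mul φ ψ).depth = max φ.depth ψ.depth + 1 := rfl

/-- A formula of depth `ℓ` has fewer than `2^(ℓ+1)` nodes (the count behind
"`log L_R(f) ≤ D_R(f)`"). [cite: HrubesYehudayoff2011, Lemma 4.1 (proof)] -/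
theorem size_lt_two_pow_depth (φ : NCFormula A σ) : φ.size < 2 ^ (φ.depth + 1) := by
  suffices h : φ.size + 1 ≤ 2 ^ (φ.depth + 1) by omega
  induction φ with
  | var i => simp
  | const c => simp
  | add φ ψ ihφ ihψ =>
    rw [size_add, depth_add, pow_succ]
    have h1 : 2 ^ (φ.depth + 1) ≤ 2 ^ (max φ.depth ψ.depth + 1) :=
      Nat.pow_le_pow_right Nat.two_pos (Nat.add_le_add_right (le_max_left _ _) 1)
    have h2 : 2 ^ (ψ.depth + 1) ≤ 2 ^ (max φ.depth ψ.depth + 1) :=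
      Nat.pow_le_pow_right Nat.two_pos (Nat.add_le_add_right (le_max_right _ _) 1)
    omega
  | mul φ ψ ihφ ihψ =>
    rw [size_mul, depth_mul, pow_succ]
    have h1 : 2 ^ (φ.depth + 1) ≤ 2 ^ (max φ.depth ψ.depth + 1) :=
      Nat.pow_le_pow_right Nat.two_pos (Nat.add_le_add_right (le_max_left _ _) 1)
    have h2 : 2 ^ (ψ.depth + 1) ≤ 2 ^ (max φ.depth ψ.depth + 1) :=
      Nat.pow_le_pow_right Nat.two_pos (Nat.add_le_add_right (le_max_right _ _) 1)
    omega

/-- Depth is less than size. [folklore] -/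
theorem depth_lt_size (φ : NCFormula A σ) : φ.depth < φ.size := by
  induction φ with
  | var i => simp
  | const c => simp
  | add φ ψ ihφ ihψ => rw [size_add, depth_add]; omega
  | mul φ ψ ihφ ihψ => rw [size_mul, depth_mul]; omega

/-! ### Balanced binary sums -/

/-- The balanced binary sum of `v s, v (s+1), …, v (s + 2^m - 1)` (a complete binary tree of sum
gates of depth `m`). [folklore] -/
def bsum (v : ℕ → NCFormula A σ) : ℕ → ℕ → NCFormula A σ
  | 0, s => v s
  | m + 1, s => add (bsum v m s) (bsum v m (s + 2 ^ m))

/-- Depth of a balanced sum: `m` plus the depth of the summands. [folklore] -/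
theorem depth_bsum_le (v : ℕ → NCFormula A σ) {D : ℕ} (h : ∀ i, (v i).depth ≤ D) (m s : ℕ) :
    (bsum v m s).depth ≤ D + m := by
  induction m generalizing s with
  | zero => simpa [bsum] using h s
  | succ m ih =>
    have h1 := ih s
    have h2 := ih (s + 2 ^ m)
    rw [bsum, depth_add]
    omega

variable [Semiring A]

/-- A balanced sum computes the sum. [folklore] -/
theorem eval_bsum (v : ℕ → NCFormula A σ) (m s : ℕ) :
    (bsum v m s).eval = ∑ i ∈ Finset.range (2 ^ m), (v (s + i)).eval := by
  induction m generalizing s with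
  | zero => simp [bsum]
  | succ m ih =>
    rw [bsum, eval_add, ih, ih, pow_succ, mul_two, Finset.sum_range_add]
    simp only [add_assoc]

/-- The balanced sum of a `Fin k`-indexed family, padded with zero leaves to `2^(⌊log₂ k⌋+1)`
summands (the depth-`O(log k)` adders of the simulation). [cite: HrubesYehudayoff2011, Thm. 4.2 (proof: "depth at most `c log k`")] -/
def finSum {k : ℕ} (w : Fin k → NCFormula A σ) : NCFormula A σ :=
  bsum (fun i => if h : i < k then w ⟨i, h⟩ else const 0) (Nat.log 2 k + 1) 0

/-- `finSum` computes `∑ i, w i`. [folklore] -/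
theorem eval_finSum {k : ℕ} (w : Fin k → NCFormula A σ) :
    (finSum w).eval = ∑ i, (w i).eval := by
  have hk : k ≤ 2 ^ (Nat.log 2 k + 1) := (Nat.lt_pow_succ_log_self Nat.one_lt_two k).le
  rw [finSum, eval_bsum, ← Finset.sum_subset (Finset.range_subset_range.mpr hk)]
  · rw [Finset.sum_range]
    refine Finset.sum_congr rfl fun i _ => ?_
    simp
  · intro i _ hi
    rw [Finset.mem_range, not_lt] at hi
    have hi' : ¬ i < k := not_lt.mpr hi
    simp [hi']

/-- Depth of `finSum`: `⌊log₂ k⌋ + 1` plus the depth of the summands. [folklore] -/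
theorem depth_finSum_le {k D : ℕ} (w : Fin k → NCFormula A σ) (h : ∀ i, (w i).depth ≤ D) :
    (finSum w).depth ≤ D + (Nat.log 2 k + 1) := by
  refine depth_bsum_le _ (fun i => ?_) _ _
  split
  · exact h _
  · simp

/-! ### Splitting a formula at a heavy node (Brent–Spira restructuring) -/

/-- `(const 1) × φ × (const 1) + const 0` evaluates to `φ`. [folklore] -/
theorem eval_pieces_trivial (φ : NCFormula A σ) :
    (const 1 : NCFormula A σ).eval * φ.eval * (const 1 : NCFormula A σ).eval
      + (const 0 : NCFormula A σ).eval = φ.eval := by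
  rw [eval_const, eval_const, ← one_def, single_zero, one_mul, mul_one, add_zero]

/-- Split `φ` at the first node, descending from the root into a child of size `≥ t` as long as
there is one, all of whose children have size `< t` (the node "`u`" of size between `s/3` and
`2s/3` of the printed proof, for `t ≈ s/3`). [cite: HrubesYehudayoff2011, Lemma 4.1 (proof)] -/
def splitAt (t : ℕ) : NCFormula A σ → Pieces A σ
  | var i => ⟨const 1, var i, const 1, const 0⟩
  | const c => ⟨const 1, const c, const 1, const 0⟩
  | add φ ψ =>
    if t ≤ φ.size then
      ⟨(splitAt t φ).a, (splitAt t φ).g, (splitAt t φ).b, add (splitAt t φ).c ψ⟩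
    else if t ≤ ψ.size then
      ⟨(splitAt t ψ).a, (splitAt t ψ).g, (splitAt t ψ).b, add φ (splitAt t ψ).c⟩
    else ⟨const 1, add φ ψ, const 1, const 0⟩
  | mul φ ψ =>
    if t ≤ φ.size then
      ⟨(splitAt t φ).a, (splitAt t φ).g, mul (splitAt t φ).b ψ, mul (splitAt t φ).c ψ⟩
    else if t ≤ ψ.size then
      ⟨mul φ (splitAt t ψ).a, (splitAt t ψ).g, (splitAt t ψ).b, mul φ (splitAt t ψ).c⟩
    else ⟨const 1, mul φ ψ, const 1, const 0⟩

/-- **The restructuring identity** `φ = a · g · b + c` (noncommutative coefficients, so both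
cofactors are needed). [cite: HrubesYehudayoff2011, Lemma 4.1 (proof)] -/
theorem eval_splitAt (t : ℕ) (φ : NCFormula A σ) :
    (splitAt t φ).a.eval * (splitAt t φ).g.eval * (splitAt t φ).b.eval + (splitAt t φ).c.eval
      = φ.eval := by
  induction φ with
  | var i => simp only [splitAt]; exact eval_pieces_trivial _
  | const c => simp only [splitAt]; exact eval_pieces_trivial _
  | add φ ψ ihφ ihψ =>
    simp only [splitAt]
    split_ifs
    · simp only [eval_add]
      rw [← ihφ, add_assoc]
    · simp only [eval_add]
      rw [← ihψ, add_left_comm]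
    · exact eval_pieces_trivial _
  | mul φ ψ ihφ ihψ =>
    simp only [splitAt]
    split_ifs
    · simp only [eval_mul]
      rw [← ihφ, add_mul, ← mul_assoc]
    · simp only [eval_mul]
      rw [← ihψ, mul_add, ← mul_assoc, ← mul_assoc]
    · exact eval_pieces_trivial _

/-- The split-off subformula has size in `[t, 2t-1]` (when `1 ≤ t ≤ |φ|`).
[cite: HrubesYehudayoff2011, Lemma 4.1 (proof: "of size between `s/3` and `2s/3`")] -/
theorem splitAt_g_size {t : ℕ} (ht : 1 ≤ t) (φ : NCFormula A σ) (hφ : t ≤ φ.size) :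
    t ≤ (splitAt t φ).g.size ∧ (splitAt t φ).g.size + 1 ≤ 2 * t := by
  induction φ with
  | var i => simp only [splitAt, size_var] at hφ ⊢; omega
  | const c => simp only [splitAt, size_const] at hφ ⊢; omega
  | add φ ψ ihφ ihψ =>
    simp only [splitAt]
    split_ifs with h₁ h₂
    · exact ihφ h₁
    · exact ihψ h₂
    · simp only [size_add] at hφ ⊢; omega
  | mul φ ψ ihφ ihψ =>
    simp only [splitAt]
    split_ifs with h₁ h₂
    · exact ihφ h₁
    · exact ihψ h₂
    · simp only [size_mul] at hφ ⊢; omega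

/-- Each of the three other pieces has size `≤ |φ| - |g| + 1`.
[cite: HrubesYehudayoff2011, Lemma 4.1 (proof: "formulas of size at most `2s/3`")] -/
theorem splitAt_sizes (t : ℕ) (φ : NCFormula A σ) :
    (splitAt t φ).a.size + (splitAt t φ).g.size ≤ φ.size + 1 ∧
    (splitAt t φ).b.size + (splitAt t φ).g.size ≤ φ.size + 1 ∧
    (splitAt t φ).c.size + (splitAt t φ).g.size ≤ φ.size + 1 := by
  induction φ with
  | var i => simp [splitAt]
  | const c => simp [splitAt]
  | add φ ψ ihφ ihψ =>
    simp only [splitAt]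
    split_ifs
    · simp only [size_add]; omega
    · simp only [size_add]; omega
    · simp only [size_add, size_const]; omega
  | mul φ ψ ihφ ihψ =>
    simp only [splitAt]
    split_ifs
    · simp only [size_mul]; omega
    · simp only [size_mul]; omega
    · simp only [size_mul, size_const]; omega

/-! ### Balancing (Lemma 4.1) -/

/-- Balancing, quantitative step: a formula of size `≤ (6/5)^m` is equivalent to one of depth
`≤ 3m + 4`. [cite: HrubesYehudayoff2011, Lemma 4.1 (proof)] -/
theorem exists_depth_le_of_size (m : ℕ) : ∀ φ : NCFormula A σ, φ.size * 5 ^ m ≤ 6 ^ m →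
    ∃ ψ : NCFormula A σ, ψ.eval = φ.eval ∧ ψ.depth ≤ 3 * m + 4 := by
  induction m with
  | zero =>
    intro φ h
    rw [pow_zero, pow_zero, mul_one] at h
    exact ⟨φ, rfl, by have := φ.depth_lt_size; omega⟩
  | succ m ih =>
    intro φ h
    by_cases hs : φ.size ≤ 5
    · exact ⟨φ, rfl, by have := φ.depth_lt_size; omega⟩
    · have key : ∀ p : NCFormula A σ, 6 * p.size ≤ 5 * φ.size → p.size * 5 ^ m ≤ 6 ^ m := by
        intro p hp
        refine le_of_mul_le_mul_right ?_ (by norm_num : (0 : ℕ) < 6)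
        calc p.size * 5 ^ m * 6 = 6 * p.size * 5 ^ m := by ring
          _ ≤ 5 * φ.size * 5 ^ m := Nat.mul_le_mul_right _ hp
          _ = φ.size * 5 ^ (m + 1) := by ring
          _ ≤ 6 ^ (m + 1) := h
          _ = 6 ^ m * 6 := pow_succ 6 m
      obtain ⟨hg₁, hg₂⟩ :=
        splitAt_g_size (t := φ.size / 3 + 1) (by omega) φ (by omega)
      obtain ⟨ha, hb, hc⟩ := splitAt_sizes (φ.size / 3 + 1) φ
      obtain ⟨ψa, ea, da⟩ := ih (splitAt (φ.size / 3 + 1) φ).a (key _ (by omega))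
      obtain ⟨ψg, eg, dg⟩ := ih (splitAt (φ.size / 3 + 1) φ).g (key _ (by omega))
      obtain ⟨ψb, eb, db⟩ := ih (splitAt (φ.size / 3 + 1) φ).b (key _ (by omega))
      obtain ⟨ψc, ec, dc⟩ := ih (splitAt (φ.size / 3 + 1) φ).c (key _ (by omega))
      refine ⟨add (mul (mul ψa ψg) ψb) ψc, ?_, ?_⟩
      · rw [eval_add, eval_mul, eval_mul, ea, eg, eb, ec, eval_splitAt]
      · rw [depth_add, depth_mul, depth_mul]
        omega

/-- **Lemma 4.1, constructive form (Brent–Spira balancing over a noncommutative ring):** every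
formula of size `s` is equivalent to a formula of depth `≤ 12 ⌊log₂ s⌋ + 16`.
[cite: HrubesYehudayoff2011, Lemma 4.1] -/
theorem exists_depth_le_log (φ : NCFormula A σ) :
    ∃ ψ : NCFormula A σ, ψ.eval = φ.eval ∧ ψ.depth ≤ 12 * Nat.log 2 φ.size + 16 := by
  have hL := Nat.lt_pow_succ_log_self Nat.one_lt_two φ.size
  have key : φ.size * 5 ^ (4 * (Nat.log 2 φ.size + 1)) ≤ 6 ^ (4 * (Nat.log 2 φ.size + 1)) := by
    rw [pow_mul, pow_mul]
    calc φ.size * (5 ^ 4) ^ (Nat.log 2 φ.size + 1)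
        ≤ 2 ^ (Nat.log 2 φ.size + 1) * (5 ^ 4) ^ (Nat.log 2 φ.size + 1) :=
          Nat.mul_le_mul_right _ hL.le
      _ = (2 * 5 ^ 4) ^ (Nat.log 2 φ.size + 1) := by rw [mul_pow]
      _ ≤ (6 ^ 4) ^ (Nat.log 2 φ.size + 1) := Nat.pow_le_pow_left (by norm_num) _
  obtain ⟨ψ, h1, h2⟩ := exists_depth_le_of_size (4 * (Nat.log 2 φ.size + 1)) φ key
  exact ⟨ψ, h1, by omega⟩

end NCFormula

/-- **`D_A(g)`**: the least depth of a formula over `A` computing `g ∈ A[X]` (the printed `D_R(f)`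
is the least depth of a CIRCUIT; unfolding a circuit into a tree preserves depth, so the two
agree; the tree's model has formulas only). [cite: HrubesYehudayoff2011, §2 ("`D_R(f)` denotes the smallest depth of a circuit computing `f` in `R`")] -/
def ncFormulaDepth {A : Type u} [Semiring A] {σ : Type v} (g : AddMonoidAlgebra A (σ →₀ ℕ)) : ℕ :=
  sInf {D | ∃ φ : NCFormula A σ, φ.eval = g ∧ φ.depth = D}

/-- **Hrubeš–Yehudayoff Lemma 4.1, first inequality:** `log L_A(g) ≤ D_A(g)`.
[cite: HrubesYehudayoff2011, Lemma 4.1] -/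
theorem log_ncFormulaSize_le_ncFormulaDepth {A : Type u} [Semiring A] {σ : Type v}
    (g : AddMonoidAlgebra A (σ →₀ ℕ)) : Nat.log 2 (ncFormulaSize g) ≤ ncFormulaDepth g := by
  obtain ⟨φ₀, h₀⟩ := NCFormula.exists_eval_eq g
  have hne : {D | ∃ φ : NCFormula A σ, φ.eval = g ∧ φ.depth = D}.Nonempty :=
    ⟨φ₀.depth, φ₀, h₀, rfl⟩
  obtain ⟨φ, hφ, hD⟩ := Nat.sInf_mem hne
  have h1 : ncFormulaSize g < 2 ^ (φ.depth + 1) :=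
    lt_of_le_of_lt (ncFormulaSize_le_size φ hφ) φ.size_lt_two_pow_depth
  have h2 := Nat.log_lt_of_lt_pow (Nat.one_le_iff_ne_zero.mp (one_le_ncFormulaSize g)) h1
  rw [ncFormulaDepth, ← hD]
  omega

/-- **Hrubeš–Yehudayoff Lemma 4.1, second inequality (explicit constant):**
`D_A(g) ≤ 12 ⌊log₂ L_A(g)⌋ + 16`, over every (noncommutative) semiring `A`.
[cite: HrubesYehudayoff2011, Lemma 4.1] -/
theorem ncFormulaDepth_le_log_ncFormulaSize {A : Type u} [Semiring A] {σ : Type v}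
    (g : AddMonoidAlgebra A (σ →₀ ℕ)) :
    ncFormulaDepth g ≤ 12 * Nat.log 2 (ncFormulaSize g) + 16 := by
  obtain ⟨φ₀, h₀⟩ := NCFormula.exists_eval_eq g
  have hne : {s | ∃ φ : NCFormula A σ, φ.eval = g ∧ φ.size = s}.Nonempty :=
    ⟨φ₀.size, φ₀, h₀, rfl⟩
  obtain ⟨φ, hφ, hs⟩ := Nat.sInf_mem hne
  obtain ⟨ψ, hψ, hd⟩ := φ.exists_depth_le_log
  have : ncFormulaDepth g ≤ ψ.depth := Nat.sInf_le ⟨ψ, hψ.trans hφ, rfl⟩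
  rw [ncFormulaSize, ← hs]
  omega

/-- **Hrubeš–Yehudayoff Lemma 4.1, second inequality, printed shape** `D_A(g) ≤ c · log L_A(g)`
(with `c = 28`; a smallest formula of size `1` is a leaf, of depth `0`).
[cite: HrubesYehudayoff2011, Lemma 4.1] -/
theorem ncFormulaDepth_le_mul_log_ncFormulaSize {A : Type u} [Semiring A] {σ : Type v}
    (g : AddMonoidAlgebra A (σ →₀ ℕ)) :
    ncFormulaDepth g ≤ 28 * Nat.log 2 (ncFormulaSize g) := by
  have h16 := ncFormulaDepth_le_log_ncFormulaSize g
  have h1 := one_le_ncFormulaSize g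
  by_cases hs1 : ncFormulaSize g = 1
  · obtain ⟨φ₀, h₀⟩ := NCFormula.exists_eval_eq g
    have hne : {s | ∃ φ : NCFormula A σ, φ.eval = g ∧ φ.size = s}.Nonempty :=
      ⟨φ₀.size, φ₀, h₀, rfl⟩
    obtain ⟨φ, hφ, hs⟩ := Nat.sInf_mem hne
    change φ.size = ncFormulaSize g at hs
    have hD : ncFormulaDepth g ≤ φ.depth := Nat.sInf_le ⟨φ, hφ, rfl⟩
    have := φ.depth_lt_size
    omega
  · have hlog : 1 ≤ Nat.log 2 (ncFormulaSize g) := Nat.log_pos Nat.one_lt_two (by omega)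
    omega

/-! ### Simulating an extension of dimension `k` over the base ring (Theorem 4.2) -/

section Simulation

variable {R : Type u} [CommRing R] {R' : Type v} [Ring R'] [Algebra R R'] {k : ℕ}
  (e : Module.Basis (Fin k) R R') {σ : Type*}

/-- **`g_l`**: the `l`-th coordinate polynomial of `g ∈ R'[X]` in the basis `e`
("for `g = ∑ g_J x^J ∈ R'[X]` and `i ∈ {1,…,k}`, define `g_i ∈ R[X]` as `∑_J g_{J,i} x^J`").
[cite: HrubesYehudayoff2011, Thm. 4.2 (proof)] -/
def coordPoly (l : Fin k) (g : AddMonoidAlgebra R' (σ →₀ ℕ)) : AddMonoidAlgebra R (σ →₀ ℕ) :=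
  AddMonoidAlgebra.map (e.coord l).toAddMonoidHom g

/-- Coefficients of the coordinate polynomial. [folklore] -/
@[simp]
theorem coeff_coordPoly (l : Fin k) (g : AddMonoidAlgebra R' (σ →₀ ℕ)) (m : σ →₀ ℕ) :
    (coordPoly e l g).coeff m = e.repr (g.coeff m) l := by
  simp [coordPoly]

/-- `coordPoly` is additive. [folklore] -/
theorem coordPoly_add (l : Fin k) (g h : AddMonoidAlgebra R' (σ →₀ ℕ)) :
    coordPoly e l (g + h) = coordPoly e l g + coordPoly e l h :=
  AddMonoidAlgebra.map_add _ _ _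

/-- `coordPoly` of zero. [folklore] -/
theorem coordPoly_zero (l : Fin k) : coordPoly e l (0 : AddMonoidAlgebra R' (σ →₀ ℕ)) = 0 :=
  AddMonoidAlgebra.map_zero _

/-- `coordPoly` of a monomial. [folklore] -/
theorem coordPoly_single (l : Fin k) (m : σ →₀ ℕ) (x : R') :
    coordPoly e l (single m x) = single m (e.repr x l) := by
  simp [coordPoly]

/-- Coordinates of a product through the structure constants `(e_i e_j)_l` (the bilinear maps
`λ_l` of the printed proof: "(a · b)_i = λ_i(ā, b̄)"). [cite: HrubesYehudayoff2011, Thm. 4.2 (proof)] -/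
theorem repr_mul_apply (x y : R') (l : Fin k) :
    e.repr (x * y) l = ∑ i, ∑ j, e.repr x i * e.repr y j * e.repr (e i * e j) l := by
  rw [show e.repr (x * y) l = e.repr ((∑ i, e.repr x i • e i) * (∑ j, e.repr y j • e j)) l by
    rw [e.sum_repr, e.sum_repr]]
  simp only [Finset.sum_mul, Finset.mul_sum, Algebra.smul_mul_assoc, Algebra.mul_smul_comm,
    map_sum, map_smul, Finsupp.finsetSum_apply, Finsupp.smul_apply, smul_eq_mul]
  conv_lhs => rw [Finset.sum_comm]
  refine Finset.sum_congr rfl fun i _ => Finset.sum_congr rfl fun j _ => ?_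
  ring

/-- A sum of monomials with the same exponent. [folklore] -/
theorem single_finset_sum' {B : Type*} [Semiring B] {M : Type*} {ι : Type*} (m : M)
    (s : Finset ι) (f : ι → B) :
    (single m (∑ i ∈ s, f i) : AddMonoidAlgebra B M) = ∑ i ∈ s, single m (f i) :=
  map_sum (singleAddHom m) f s

/-- **The product rule of the simulation:** `(g h)_l = ∑_{i,j} (e_i e_j)_l · g_i h_j`.
[cite: HrubesYehudayoff2011, Thm. 4.2 (proof)] -/
theorem coordPoly_mul (l : Fin k) (g h : AddMonoidAlgebra R' (σ →₀ ℕ)) :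
    coordPoly e l (g * h) =
      ∑ i, ∑ j, e.repr (e i * e j) l • (coordPoly e i g * coordPoly e j h) := by
  induction g using AddMonoidAlgebra.induction_linear with
  | zero => simp [coordPoly_zero]
  | add g₁ g₂ h₁ h₂ =>
    simp only [add_mul, coordPoly_add, h₁, h₂, smul_add, Finset.sum_add_distrib]
  | single m x =>
    induction h using AddMonoidAlgebra.induction_linear with
    | zero => simp [coordPoly_zero]
    | add g₁ g₂ h₁ h₂ =>
      simp only [mul_add, coordPoly_add, h₁, h₂, smul_add, Finset.sum_add_distrib]
    | single m' y =>
      rw [single_mul_single, coordPoly_single, repr_mul_apply, single_finset_sum']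
      refine Finset.sum_congr rfl fun i _ => ?_
      rw [single_finset_sum']
      refine Finset.sum_congr rfl fun j _ => ?_
      rw [coordPoly_single, coordPoly_single, single_mul_single, smul_single, smul_eq_mul,
        mul_comm (e.repr (e i * e j) l)]

/-- Multiplication by a constant monomial is the scalar action. [folklore] -/
theorem single_zero_mul_eq_smul' {B : Type*} [Semiring B] {M : Type*} [AddMonoid M] (r : B)
    (x : AddMonoidAlgebra B M) : single (0 : M) r * x = r • x := by
  refine AddMonoidAlgebra.ext (Finsupp.ext fun m => ?_)
  rw [coeff_single_zero_mul, coeff_smul, Finsupp.smul_apply, smul_eq_mul]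

/-- **The componentwise simulation** of a formula over `R'` by `k` formulas over `R`
("for every node `u` in `Φ` … the circuit `Ψ` contains nodes `u_1, …, u_k` computing
`g_u,1, …, g_u,k`": leaves coordinatewise, sums coordinatewise, a product gate through the
structure constants with balanced adders). [cite: HrubesYehudayoff2011, Thm. 4.2 (proof)] -/
def NCFormula.sim : NCFormula R' σ → Fin k → NCFormula R σ
  | .var i, l => .mul (.const (e.repr 1 l)) (.var i)
  | .const c, l => .const (e.repr c l)
  | .add φ ψ, l => .add (NCFormula.sim φ l) (NCFormula.sim ψ l)
  | .mul φ ψ, l => NCFormula.finSum fun i : Fin k => NCFormula.finSum fun j : Fin k =>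
      .mul (.const (e.repr (e i * e j) l)) (.mul (NCFormula.sim φ i) (NCFormula.sim ψ j))

/-- **Correctness of the simulation:** the `l`-th simulating formula computes the `l`-th
coordinate polynomial. [cite: HrubesYehudayoff2011, Thm. 4.2 (proof: "`u_i` computes `g_u,i`")] -/
theorem NCFormula.eval_sim (φ : NCFormula R' σ) (l : Fin k) :
    (φ.sim e l).eval = coordPoly e l φ.eval := by
  induction φ generalizing l with
  | var i =>
    rw [NCFormula.sim, NCFormula.eval_mul, NCFormula.eval_const, NCFormula.eval_var,
      NCFormula.eval_var, coordPoly_single, single_mul_single, zero_add, mul_one]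
  | const c => rw [NCFormula.sim, NCFormula.eval_const, NCFormula.eval_const, coordPoly_single]
  | add φ ψ ihφ ihψ =>
    rw [NCFormula.sim, NCFormula.eval_add, NCFormula.eval_add, coordPoly_add, ihφ, ihψ]
  | mul φ ψ ihφ ihψ =>
    rw [NCFormula.sim, NCFormula.eval_finSum, NCFormula.eval_mul, coordPoly_mul]
    refine Finset.sum_congr rfl fun i _ => ?_
    rw [NCFormula.eval_finSum]
    refine Finset.sum_congr rfl fun j _ => ?_
    rw [NCFormula.eval_mul, NCFormula.eval_mul, NCFormula.eval_const, ihφ, ihψ,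
      single_zero_mul_eq_smul']

/-- Bookkeeping for the depth recursion of the simulation. [folklore] -/
private theorem depth_arith {a b x y K c : ℕ} (hx : x ≤ a * K + 1) (hy : y ≤ b * K + 1)
    (hc : c + 1 ≤ K) : max x y + c + 1 ≤ (max a b + 1) * K + 1 := by
  have ha : a * K ≤ max a b * K := Nat.mul_le_mul_right K (le_max_left a b)
  have hb : b * K ≤ max a b * K := Nat.mul_le_mul_right K (le_max_right a b)
  rw [add_mul, one_mul]
  generalize max a b * K = M at ha hb ⊢
  generalize a * K = P at ha hx
  generalize b * K = Q at hb hy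
  omega

/-- **Depth of the simulation:** `depth (sim φ l) ≤ depth φ · (2 ⌊log₂ k⌋ + 4) + 1` ("its depth is
at most `d · O(log k)`"). [cite: HrubesYehudayoff2011, Thm. 4.2 (proof)] -/
theorem NCFormula.depth_sim_le (φ : NCFormula R' σ) (l : Fin k) :
    (φ.sim e l).depth ≤ φ.depth * (2 * Nat.log 2 k + 4) + 1 := by
  induction φ generalizing l with
  | var i => simp [NCFormula.sim]
  | const c => simp [NCFormula.sim]
  | add φ ψ ihφ ihψ =>
    rw [NCFormula.sim, NCFormula.depth_add, NCFormula.depth_add]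
    have := depth_arith (c := 0) (ihφ l) (ihψ l) (by omega)
    rwa [add_zero] at this
  | mul φ ψ ihφ ihψ =>
    rw [NCFormula.sim, NCFormula.depth_mul]
    generalize hK : 2 * Nat.log 2 k + 4 = K at ihφ ihψ ⊢
    have hD : ∀ i j : Fin k,
        (NCFormula.mul (.const (e.repr (e i * e j) l)) (.mul (φ.sim e i) (ψ.sim e j)) :
            NCFormula R σ).depth
          ≤ max (φ.depth * K + 1) (ψ.depth * K + 1) + 2 := by
      intro i j
      have h1 := ihφ i
      have h2 := ihψ j
      simp only [NCFormula.depth_mul, NCFormula.depth_const]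
      omega
    refine (NCFormula.depth_finSum_le _ fun i => NCFormula.depth_finSum_le _ fun j => hD i j).trans
      ?_
    have ha : φ.depth * K ≤ max φ.depth ψ.depth * K := Nat.mul_le_mul_right K (le_max_left _ _)
    have hb : ψ.depth * K ≤ max φ.depth ψ.depth * K := Nat.mul_le_mul_right K (le_max_right _ _)
    rw [add_mul, one_mul]
    generalize max φ.depth ψ.depth * K = M at ha hb ⊢
    generalize φ.depth * K = P at ha ⊢
    generalize ψ.depth * K = Q at hb ⊢
    omega

/-- The coordinate at `e_{i₀} = 1` of `f ∈ R[X] ⊆ R'[X]` is `f` itself ("since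
`f ∈ R[x_1,…,x_n]`, we have `f = f_0`, and hence `u_0` computes `f`").
[cite: HrubesYehudayoff2011, Thm. 4.2 (proof)] -/
theorem coordPoly_baseChange {i₀ : Fin k} (hi₀ : e i₀ = 1) (f : MvPolynomial σ R) :
    coordPoly e i₀ (baseChange R' f) = baseChange R f := by
  refine AddMonoidAlgebra.ext (Finsupp.ext fun m => ?_)
  rw [coeff_coordPoly, coeff_baseChange, coeff_baseChange,
    Algebra.algebraMap_eq_smul_one (A := R'), map_smul, Finsupp.smul_apply, ← hi₀, e.repr_self,
    Finsupp.single_eq_same, smul_eq_mul, mul_one, Algebra.algebraMap_self_apply]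

/-- **Theorem 4.2 (formulas), explicit form.** If `R'` has an `R`-basis `e : Fin k → R'` with
`e i₀ = 1`, then for every `f ∈ R[x_1,…,x_n]`,
`L_R(f) ≤ L_{R'}(f) ^ (114 (⌊log₂ k⌋ + 1))`. [cite: HrubesYehudayoff2011, Thm. 4.2] -/
theorem ncFormulaSize_le_pow_of_basis {i₀ : Fin k} (hi₀ : e i₀ = 1) {n : ℕ}
    (f : MvPolynomial (Fin n) R) :
    ncFormulaSize (baseChange R f) ≤
      ncFormulaSize (baseChange R' f) ^ (114 * (Nat.log 2 k + 1)) := by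
  -- a smallest formula `φ` for `f` over `R'`
  obtain ⟨φ₀, h₀⟩ := NCFormula.exists_eval_eq (baseChange R' f)
  have hne : {s | ∃ φ : NCFormula R' (Fin n), φ.eval = baseChange R' f ∧ φ.size = s}.Nonempty :=
    ⟨φ₀.size, φ₀, h₀, rfl⟩
  obtain ⟨φ, hφ, hφs⟩ := Nat.sInf_mem hne
  change φ.size = ncFormulaSize (baseChange R' f) at hφs
  generalize hs : ncFormulaSize (baseChange R' f) = s at hφs ⊢
  have hs1 : 1 ≤ s := by rw [← hs]; exact one_le_ncFormulaSize _
  have key : coordPoly e i₀ φ.eval = baseChange R f := by rw [hφ, coordPoly_baseChange e hi₀]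
  by_cases h1 : s = 1
  · -- `φ` is a leaf: so is its simulation
    subst h1
    rw [one_pow]
    cases φ with
    | var i =>
      refine ncFormulaSize_le_size (NCFormula.var i) ?_
      rw [← key, NCFormula.eval_var, NCFormula.eval_var, coordPoly_single, ← hi₀, e.repr_self,
        Finsupp.single_eq_same]
    | const c =>
      refine ncFormulaSize_le_size (NCFormula.const (e.repr c i₀)) ?_
      rw [← key, NCFormula.eval_const, NCFormula.eval_const, coordPoly_single]
    | add φ ψ =>
      exfalso
      have := φ.one_le_size
      have := ψ.one_le_size
      simp only [NCFormula.size_add] at hφs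
      omega
    | mul φ ψ =>
      exfalso
      have := φ.one_le_size
      have := ψ.one_le_size
      simp only [NCFormula.size_mul] at hφs
      omega
  · -- balance, simulate, unfold
    have hs2 : 2 ≤ s := by omega
    obtain ⟨ψ, hψ, hψd⟩ := φ.exists_depth_le_log
    rw [hφs] at hψd
    have hχ : (ψ.sim e i₀).eval = baseChange R f := by rw [NCFormula.eval_sim, hψ, key]
    have hχd := ψ.depth_sim_le e i₀
    have hχs := (ψ.sim e i₀).size_lt_two_pow_depth
    refine (ncFormulaSize_le_size _ hχ).trans ?_
    generalize hL : Nat.log 2 s = L at hψd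
    generalize Nat.log 2 k = M at hχd ⊢
    have h2L : 2 ^ L ≤ s := by rw [← hL]; exact Nat.pow_log_le_self 2 (by omega)
    have hL1 : 1 ≤ L := by rw [← hL]; exact Nat.log_pos Nat.one_lt_two hs2
    have hd : (ψ.sim e i₀).depth + 1 ≤ L * (114 * (M + 1)) := by
      have e1 : ψ.depth * (2 * M + 4) ≤ (12 * L + 16) * (2 * M + 4) :=
        Nat.mul_le_mul_right _ hψd
      have e2 : (12 * L + 16) * (2 * M + 4) ≤ (28 * L) * (4 * (M + 1)) :=
        Nat.mul_le_mul (by omega) (by omega)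
      have e3 : 1 * 2 ≤ L * (2 * (M + 1)) := Nat.mul_le_mul hL1 (by omega)
      have e4 : 28 * L * (4 * (M + 1)) + L * (2 * (M + 1)) = L * (114 * (M + 1)) := by ring
      generalize ψ.depth * (2 * M + 4) = A1 at e1 hχd
      generalize (12 * L + 16) * (2 * M + 4) = A2 at e1 e2
      generalize 28 * L * (4 * (M + 1)) = A3 at e2 e4
      generalize L * (2 * (M + 1)) = A4 at e3 e4
      generalize L * (114 * (M + 1)) = A5 at e4 ⊢
      omega
    calc (ψ.sim e i₀).size ≤ 2 ^ ((ψ.sim e i₀).depth + 1) := hχs.le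
      _ ≤ 2 ^ (L * (114 * (M + 1))) := Nat.pow_le_pow_right Nat.two_pos hd
      _ = (2 ^ L) ^ (114 * (M + 1)) := pow_mul 2 L _
      _ ≤ s ^ (114 * (M + 1)) := Nat.pow_le_pow_left h2L _

end Simulation

/-- **Hrubeš–Yehudayoff 2011, Thm. 4.2 (formula half) holds**, with `c = 114`:
`L_R(f) ≤ L_{R'}(f)^(114 (⌊log₂ k⌋ + 1))` whenever `R'` has an `R`-basis of size `k` containing
`1`. [cite: HrubesYehudayoff2011, Thm. 4.2] -/
theorem HrubesYehudayoff2011_thm42_formulas_holds : HrubesYehudayoff2011_thm42_formulas.{u} := by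
  refine ⟨114, ?_⟩
  intro R _ R' _ _ k e hi n f
  obtain ⟨i₀, hi₀⟩ := hi
  exact ncFormulaSize_le_pow_of_basis e hi₀ f

end Literature.Barriers.ValiantsHypothesis
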